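import Mathlib
import Summits.NavierStokesRegularity.NavierStokesRegularity.Theorems.FilamentSkeletonRssDefectColumnGateRadialBlock

/-!
# Route `FilamentSkeletonRss` · cruxes `TransverseReduction1AL` (stmt-NavierStokesRegularity-23297) / `TransverseReduction1AR` (stmt-23611) ·
# registered stub S2a-loc `WaistColumnGateLoc1A` — the m = 0 radial block at SMALL axial frequency: the LEAD's bound survives `|ν| ≤ ν₀(γ)`

Helper file (theorems only, def-free; `--supports stmt-NavierStokesRegularity-23297 --as helper`; hand leafhand-ns-filamentskeletonrs-13 g0).

WHY.  `Theorems/…AxialNeutralModes.lean` (p827006) forces the sectional bricks of S2a-loc to hold for the sectional operator shifted by `iν`,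
uniformly in the axial frequency `ν ∈ ℝ`.  For the m = 0 radial block this is the real system (LEAD convention of `radialBlock_apriori`,
`u = r²`): `(4u a′ + γu a)′ = f₁ − ν b`, `(4u b′ + γu b)′ = f₂ + ν a`.  THIS FILE: the small-frequency end is harmless — treating `−νb`, `+νa` as
data and ABSORBING with the LEAD's no-loss bound `C(γ) = (1 + 13/γ)²`:
**`radialBlockShift_apriori_smallFreq`** — if `|ν|·(1+13/γ)² ≤ 1/2`, `(1+u)²|f_i| ≤ M`, `a, b` supported in `[0, U]` with zero mass, then
`(1+u)²|a|, (1+u)²|b| ≤ 4(1+13/γ)²·M` on `[0, ∞)` — uniformly in `U` and in `|ν| ≤ γ²/(2(γ+13)²)`.  (No resonance as `ν → 0`; the memo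
S2ALOC-AXIAL-ANALYSIS §5/§5b explains why the bound is expected for ALL `ν` — whole-plane resolvent on zero-mass data — which is NOT proved here:
the range `|ν| > ν₀(γ)` is open, size M–L.)  `exists_weightBound_of_support` is the boundedness bookkeeping (continuous profile, compact support).
HONEST FRAMING: elementary one-variable analysis about ONE block of ONE linear MODEL operator of a hypothetical filament-type blow-up route (MODEL
rung, negative side); `WaistColumnGateLoc1A`, `TransverseReduction1AL/1AR` are neither proved nor refuted; nothing here bears on Navier–Stokes regularity.
-/

set_option linter.dupNamespace false

noncomputable section

namespace Summit.NavierStokesRegularity.NavierStokesRegularity.Theorems.DefectColumnGate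

open scoped Topology
open Set Filter MeasureTheory intervalIntegral

/-- A profile continuous on `[0, ∞)` and vanishing on `[U, ∞)` has a finite weighted size `sup_{u ≥ 0} (1+u)²|w(u)|`. -/
theorem exists_weightBound_of_support {U : ℝ} {w : ℝ → ℝ} (hw : ContinuousOn w (Ici 0))
    (hsupp : ∀ u, U ≤ u → w u = 0) : ∃ B : ℝ, 0 ≤ B ∧ ∀ u, 0 ≤ u → (1 + u) ^ 2 * |w u| ≤ B := by
  have hg : ContinuousOn (fun u : ℝ => (1 + u) ^ 2 * |w u|) (Icc 0 U) :=
    ((continuousOn_const.add continuousOn_id).pow 2).mul ((hw.mono (fun x hx => hx.1)).abs)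
  obtain ⟨C, hC⟩ := (isCompact_Icc : IsCompact (Icc (0:ℝ) U)).exists_bound_of_continuousOn hg
  refine ⟨max C 0, le_max_right _ _, fun u hu => ?_⟩
  rcases le_or_gt u U with h | h
  · have h1 := hC u ⟨hu, h⟩
    rw [Real.norm_eq_abs, abs_of_nonneg (by positivity)] at h1
    exact h1.trans (le_max_left _ _)
  · rw [hsupp u h.le, abs_zero, mul_zero]
    exact le_max_right _ _

/-- **The m = 0 radial block at small axial frequency.**  LEAD-style hypotheses for the pair `(a, b)` (continuity on `[0,∞)`, derivatives on
`(0,∞)`, fluxes with derivatives `f₁ − νb`, `f₂ + νa`, data `(1+u)²|f_i| ≤ M`, support `[0,U]`, zero mass); if `|ν|·(1+13/γ)² ≤ 1/2` then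
`(1+u)²|a(u)| ≤ 4(1+13/γ)²M` and `(1+u)²|b(u)| ≤ 4(1+13/γ)²M` for every `u ≥ 0`. -/
theorem radialBlockShift_apriori_smallFreq {γ ν U M : ℝ} {a b a₁ b₁ f₁ f₂ : ℝ → ℝ} (hγ : 0 < γ) (hU : 0 < U)
    (hν : |ν| * (1 + 13 / γ) ^ 2 ≤ 1 / 2)
    (ha : ContinuousOn a (Ici 0)) (ha₁ : ContinuousOn a₁ (Ici 0)) (hb : ContinuousOn b (Ici 0)) (hb₁ : ContinuousOn b₁ (Ici 0))
    (hdera : ∀ u, 0 < u → HasDerivAt a (a₁ u) u) (hderb : ∀ u, 0 < u → HasDerivAt b (b₁ u) u)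
    (hΦa : ∀ u, 0 < u → HasDerivAt (fun s => 4 * s * a₁ s + γ * s * a s) (f₁ u - ν * b u) u)
    (hΦb : ∀ u, 0 < u → HasDerivAt (fun s => 4 * s * b₁ s + γ * s * b s) (f₂ u + ν * a u) u)
    (hf₁ : ∀ u, 0 < u → (1 + u) ^ 2 * |f₁ u| ≤ M) (hf₂ : ∀ u, 0 < u → (1 + u) ^ 2 * |f₂ u| ≤ M)
    (hsuppa : ∀ u, U ≤ u → a u = 0) (hsuppb : ∀ u, U ≤ u → b u = 0)
    (hmassa : ∫ u in (0:ℝ)..U, a u = 0) (hmassb : ∫ u in (0:ℝ)..U, b u = 0) :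
    ∀ u, 0 ≤ u → (1 + u) ^ 2 * |a u| ≤ 4 * (1 + 13 / γ) ^ 2 * M ∧ (1 + u) ^ 2 * |b u| ≤ 4 * (1 + 13 / γ) ^ 2 * M := by
  set C : ℝ := (1 + 13 / γ) ^ 2 with hCdef
  have hC0 : 0 ≤ C := by positivity
  have hM : 0 ≤ M := le_trans (by positivity) (hf₁ 1 one_pos)
  -- the optimal weighted sizes of `a` and `b`
  set ga : ℝ → ℝ := fun u => (1 + u) ^ 2 * |a u| with hga
  set gb : ℝ → ℝ := fun u => (1 + u) ^ 2 * |b u| with hgb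
  obtain ⟨Ba, hBa0, hBa⟩ := exists_weightBound_of_support ha hsuppa
  obtain ⟨Bb, hBb0, hBb⟩ := exists_weightBound_of_support hb hsuppb
  have hbddA : BddAbove (ga '' Ici 0) := ⟨Ba, by rintro _ ⟨u, hu, rfl⟩; exact hBa u hu⟩
  have hbddB : BddAbove (gb '' Ici 0) := ⟨Bb, by rintro _ ⟨u, hu, rfl⟩; exact hBb u hu⟩
  have hneA : (ga '' Ici 0).Nonempty := ⟨ga 0, mem_image_of_mem _ self_mem_Ici⟩
  have hneB : (gb '' Ici 0).Nonempty := ⟨gb 0, mem_image_of_mem _ self_mem_Ici⟩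
  set A : ℝ := sSup (ga '' Ici 0) with hAdef
  set B : ℝ := sSup (gb '' Ici 0) with hBdef
  have hA : ∀ u, 0 ≤ u → (1 + u) ^ 2 * |a u| ≤ A := fun u hu => le_csSup hbddA (mem_image_of_mem _ (show u ∈ Ici (0:ℝ) from hu))
  have hB : ∀ u, 0 ≤ u → (1 + u) ^ 2 * |b u| ≤ B := fun u hu => le_csSup hbddB (mem_image_of_mem _ (show u ∈ Ici (0:ℝ) from hu))
  have hA0 : 0 ≤ A := le_trans (by positivity) (hA 0 le_rfl)
  have hB0 : 0 ≤ B := le_trans (by positivity) (hB 0 le_rfl)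
  -- the shifted data are data: `(1+u)²|f₁ − νb| ≤ M + |ν|B`, `(1+u)²|f₂ + νa| ≤ M + |ν|A`
  have hda : ∀ u, 0 < u → (1 + u) ^ 2 * |f₁ u - ν * b u| ≤ M + |ν| * B := by
    intro u hu
    have h1 := hf₁ u hu
    have h2 := hB u hu.le
    have h3 : |f₁ u - ν * b u| ≤ |f₁ u| + |ν| * |b u| := by
      calc |f₁ u - ν * b u| ≤ |f₁ u| + |ν * b u| := abs_sub _ _
        _ = |f₁ u| + |ν| * |b u| := by rw [abs_mul]
    have h4 : (1 + u) ^ 2 * (|f₁ u| + |ν| * |b u|) = (1 + u) ^ 2 * |f₁ u| + |ν| * ((1 + u) ^ 2 * |b u|) := by ring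
    calc (1 + u) ^ 2 * |f₁ u - ν * b u| ≤ (1 + u) ^ 2 * (|f₁ u| + |ν| * |b u|) := by gcongr
      _ ≤ M + |ν| * B := by rw [h4]; gcongr
  have hdb : ∀ u, 0 < u → (1 + u) ^ 2 * |f₂ u + ν * a u| ≤ M + |ν| * A := by
    intro u hu
    have h1 := hf₂ u hu
    have h2 := hA u hu.le
    have h3 : |f₂ u + ν * a u| ≤ |f₂ u| + |ν| * |a u| := by
      calc |f₂ u + ν * a u| ≤ |f₂ u| + |ν * a u| := abs_add_le _ _
        _ = |f₂ u| + |ν| * |a u| := by rw [abs_mul]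
    have h4 : (1 + u) ^ 2 * (|f₂ u| + |ν| * |a u|) = (1 + u) ^ 2 * |f₂ u| + |ν| * ((1 + u) ^ 2 * |a u|) := by ring
    calc (1 + u) ^ 2 * |f₂ u + ν * a u| ≤ (1 + u) ^ 2 * (|f₂ u| + |ν| * |a u|) := by gcongr
      _ ≤ M + |ν| * A := by rw [h4]; gcongr
  -- the LEAD's no-loss bound for each component
  have hLa := radialBlock_apriori hγ hU ha ha₁ hdera hΦa hda hsuppa hmassa
  have hLb := radialBlock_apriori hγ hU hb hb₁ hderb hΦb hdb hsuppb hmassb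
  -- absorb
  have hAle : A ≤ C * (M + |ν| * B) := csSup_le hneA (by rintro _ ⟨u, hu, rfl⟩; exact hLa u hu)
  have hBle : B ≤ C * (M + |ν| * A) := csSup_le hneB (by rintro _ ⟨u, hu, rfl⟩; exact hLb u hu)
  have hsum : A + B ≤ 4 * C * M := by
    have h1 : A + B ≤ 2 * C * M + C * |ν| * (A + B) := by nlinarith
    have h2 : C * |ν| * (A + B) ≤ (A + B) / 2 := by
      have : C * |ν| ≤ 1 / 2 := by rw [mul_comm]; exact hν
      nlinarith
    linarith
  intro u hu
  exact ⟨(hA u hu).trans (by linarith), (hB u hu).trans (by linarith)⟩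

end Summit.NavierStokesRegularity.NavierStokesRegularity.Theorems.DefectColumnGate

end
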